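import Summits.HubbardSuperconductivity.HubbardSuperconductivity.Theorems.AnisotropyChordTransferFibre3N1Row
import Summits.HubbardSuperconductivity.HubbardSuperconductivity.Theorems.AnisotropyChordTransferFibre3TtailBounds
import Summits.HubbardSuperconductivity.HubbardSuperconductivity.Theorems.AnisotropyChordTransferFibre3Lam2Small
import Summits.HubbardSuperconductivity.HubbardSuperconductivity.Theorems.AnisotropyChordTransferFibre3GreenZero

/-!
# Route `AnisotropyChord` / H0 rotor rung: PartN41-B §2 `F2ClosedPlusTail` PROVED (`L ≥ 5`, `0 ≤ Δ`)

Theory-1 g22's PartN41-B §2 (ported …Fibre3N1Row): for a ground two-magnon profile `f = (1 − s)·1_{≠0}` with small part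
`s = sfun'` (`s(0) = 1 − a`, `a = Δf(x̂)`; `ŝ(0) = −a`, `ŝ(k) = c_s g(k)` off `0`, `dft_sfun'`):
`f² = 1 − 2s + s² − a²δ₀`, hence ★ `f2ClosedPlusTail_holds`:
`F₂(0) = Σ f² = V + 1 + ‖s‖² − (1 − a)² = nf2V` and `F₂(k) = −(2c_s g(k) + a²) + t(k) = c(k) + t(k)` for `k ≠ 0`.
Prover seat `hubbard-h0-rotor-p1` g26 (route lead); helper for stmt-HubbardSuperconductivity-23918 (`--supports`, helper class).
WHAT THIS IS NOT: nothing here proves superconductivity in the Hubbard model; a Fourier bookkeeping identity of ONE row of ONE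
conditional reduction.  Tree imports only; no new definitions; no sorry, no axioms.
-/

set_option linter.dupNamespace false
set_option autoImplicit false

noncomputable section

open scoped BigOperators

namespace Summit.HubbardSuperconductivity.HubbardSuperconductivity.Theorems.AnisotropyChord.Transfer.Fibre3

variable (L : ℕ) [NeZero L]

namespace OuterMaj

omit [NeZero L] in
/-- `f² = (1 − 2s + s²) − a²δ₀` pointwise for a two-magnon profile (`f(0) = 0`). [folklore] -/
theorem f_sq_eq {Δ : ℝ} {f : Tor L → ℝ} (hf0 : f 0 = 0) (r : Tor L) :
    f r ^ 2 = (1 - 2 * sfun' L Δ f r + sfun' L Δ f r ^ 2) - (if r = 0 then (Δ * f (K1 L)) ^ 2 else 0) := by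
  unfold sfun'
  by_cases hr : r = 0
  · rw [if_pos hr, if_pos hr, hr, hf0]; ring
  · rw [if_neg hr, if_neg hr]; ring

/-- the Fourier transform of `f²` in terms of `ŝ` and `FT[s²]`. [folklore] -/
theorem dft_f_sq {Δ : ℝ} {f : Tor L → ℝ} (hf0 : f 0 = 0) (k : Tor L) :
    dft L (fun r => f r ^ 2) k
      = (∑ r : Tor L, (starRingEnd ℂ) (phase L k r)) - 2 * dft L (sfun' L Δ f) k
          + dft L (fun r => sfun' L Δ f r ^ 2) k - (((Δ * f (K1 L)) ^ 2 : ℝ) : ℂ) := by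
  classical
  unfold dft
  have hpt : ∀ r : Tor L, (starRingEnd ℂ) (phase L k r) * (((fun r => f r ^ 2) r : ℝ) : ℂ)
      = (starRingEnd ℂ) (phase L k r) - 2 * ((starRingEnd ℂ) (phase L k r) * ((sfun' L Δ f r : ℝ) : ℂ))
        + (starRingEnd ℂ) (phase L k r) * (((fun r => sfun' L Δ f r ^ 2) r : ℝ) : ℂ)
        - (if r = 0 then (starRingEnd ℂ) (phase L k r) * ((((Δ * f (K1 L)) ^ 2 : ℝ)) : ℂ) else 0) := by
    intro r
    simp only []
    rw [f_sq_eq L (Δ := Δ) hf0 r]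
    split_ifs <;> push_cast <;> ring
  rw [Finset.sum_congr rfl fun r _ => hpt r, Finset.sum_sub_distrib, Finset.sum_add_distrib, Finset.sum_sub_distrib,
    Finset.sum_ite_eq' Finset.univ (0 : Tor L), ← Finset.mul_sum]
  simp only [Finset.mem_univ, if_true]
  rw [phase_zero, map_one, one_mul]

/-- ★ `F2ClosedPlusTail L Δ` holds for `L ≥ 5`, `0 ≤ Δ`. [folklore] -/
theorem f2ClosedPlusTail_holds (hL : 5 ≤ L) {Δ : ℝ} (hΔ0 : 0 ≤ Δ) : F2ClosedPlusTail L Δ := by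
  intro lam2 f hf _h0
  classical
  have hL2 : 2 ≤ L := by omega
  have hl2 : lam2 < 2 * eps1 L := by have := two_lam2_lt_eps1 L hL hΔ0 hf; linarith
  have hs := dft_sfun' L (by omega) hf.1 hl2
  have hf0 : f 0 = 0 := hf.1.1
  -- `Σ s = ŝ(0) = −a`
  have hsum_s : ∑ r : Tor L, sfun' L Δ f r = -(Δ * f (K1 L)) := by
    have h := hs 0
    rw [if_pos rfl, dft_zero] at h
    exact_mod_cast h
  constructor
  · -- `F₂(0) = Σ f² = V + 2a − a² + Σ s²`
    unfold F2
    rw [dft_zero, Complex.ofReal_re]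
    rw [Finset.sum_congr rfl fun r _ => f_sq_eq L (Δ := Δ) hf0 r, Finset.sum_sub_distrib,
      Finset.sum_ite_eq' Finset.univ (0 : Tor L)]
    simp only [Finset.mem_univ, if_true]
    rw [Finset.sum_add_distrib, Finset.sum_sub_distrib, ← Finset.mul_sum, hsum_s]
    unfold nf2V sNormSq aPar
    simp only [Finset.sum_const, Finset.card_univ, Fintype.card_prod, ZMod.card, nsmul_eq_mul, Nat.cast_mul, mul_one]
    ring
  · intro k hk
    unfold F2 tfun cK
    rw [dft_f_sq L hf0 k, sum_conj_phase_right, if_neg hk, hs k, if_neg hk]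
    have hg : gres L lam2 k = 1 / (2 * epsT L k - lam2) := by unfold gres; rw [if_neg hk]
    rw [hg]
    unfold dPar
    simp only [Complex.sub_re, Complex.add_re, Complex.zero_re, Complex.ofReal_re, Complex.mul_re,
      Complex.re_ofNat, Complex.im_ofNat, Complex.ofReal_im, mul_zero, sub_zero]
    ring

end OuterMaj

end Summit.HubbardSuperconductivity.HubbardSuperconductivity.Theorems.AnisotropyChord.Transfer.Fibre3

end
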